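import Literature.AlgebraicGeometry.Frobenioids.PerfFactorial
import Literature.AlgebraicGeometry.Frobenioids.ElementaryFrobeniusFunctor
import Literature.AlgebraicGeometry.Frobenioids.MonoidFunctors
import HarnessLib

/-!
# Frobenioids I, Def. 2.4 (ii)/(iii), `Λ = ℚ`: "if `Λ` supports `M`, then `Λ_{>0}` acts naturally on `M`" —
# the `ℚ_{>0}`-action on a perfect monoid, and "multiplication by `d ∈ ℚ_{>0}`" on a monoid `Φ` on `D`

Mochizuki, *The geometry of Frobenioids I: the general theory*, Kyushu J. Math. **62** (2008) 293–400,
§2, Definition 2.4 (ii) p. 48: "Let `Λ` be a monoid type. Then we shall say that `Λ` supports `M ∈ Ob(Mon)`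
if any of the following conditions hold: (a) `Λ = ℤ`; (b) `Λ = ℚ`, and `M` is perfect; (c) `Λ = ℝ`, … Note
that if `Λ` supports `M`, then `Λ_{>0}` acts naturally on `M`."; Definition 2.4 (iii) p. 48: "Let `Λ` be a
monoid type that supports `Φ` [cf. Definition 1.1, (ii)]; `d ∈ Λ_{>0}`. Then we shall write
`d · Φ(−) ⊆ Φ(−)` for the subfunctor of `Φ` determined by the assignment `Ob((C^istr)^lin) ∋ A ↦ d · (Φ(A))`
… Finally, multiplication by `d` on `Φ(−)` determines a 'Frobenius functor' … `F_Φ → F_Φ`"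
[cite: MochizukiFrdI2008, Def. 2.4(ii) p.48].

The tree has the action for `Λ = ℤ` (`natPosAction`, `powEnd Φ d`, seat abc-iut-L1-t2) and for `Λ = ℝ`
(`Supports.realPow`, `realPowEnd Φ hS d`, seat abc-iut-L1-d2), and for `Λ = ℚ` only the bare function
`IsPerfect.ratPosAct h d : M → M`, `d = m/n ↦ (a ↦ root_n (a^m))` (`PerfFactorial.lean`, abc-iut-L1-t2).
This file (seat abc-iut-L1-t12, row «P25-Λℚ», L1-lead R109 (3)(f)) packages the case `Λ = ℚ` exactly as
the case `Λ = ℝ` is packaged: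

* `IsPerfect.ratPow h d : M →* M` — the SAME function `IsPerfect.ratPosAct h d`, as a monoid homomorphism,
  with its laws: independence of the representation `d = m/n` (`ratPow_pow_eq`, `eq_ratPow_of_pow_eq`),
  `a^0 = 1`, `a^1 = a`, `a^{dd'} = (a^{d'})^d`, `a^{d+d'} = a^d a^{d'}`, `a^m` = the `m`-th power for
  `m ∈ ℕ`, `a^{1/n} = root_n a`, bijectivity for `d ≠ 0`; the action `ratPosAction : ℚ_{≥0} → End(M)`;
* NATURALITY ("acts naturally"): every homomorphism between perfect monoids commutes with the action
  (`IsPerfect.map_ratPow`) — because `φ(b)^n = φ(a)^m` pins `φ(b)` down;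
* "multiplication by `d ∈ ℚ_{>0}`" on a monoid `Φ` on `D` supported by `ℚ` as the natural endomorphism
  `ratPowEnd Φ hS d : Φ ⟶ Φ`, agreeing with t2's `powEnd Φ d` on `d ∈ ℕ_{≥1}` (`ratPowEnd_pnat`), and the
  subfunctor `d · Φ := imageMonoid (ratPowEnd Φ hS d)` (equal to `Φ` for `d ≠ 0`);
* `ℚ` supports every perfection `Φ^pf` (`supportsQ_perfectionFunctor`; monoid level: `supports_Q_perfection`) — the case in which print uses
  `Λ = ℚ` ([FrdI] Prop. 5.3, [FrdII] Ex. 3.3 (ii) `C^ℚ := C^pf`).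

(For `d = 0` the maps are the constant map `1`, a harmless extension of the printed `ℚ_{>0}`-action, as in
the `Λ = ℝ` file.)  Nothing here is specific to the abc programme.
-/

noncomputable section

namespace Literature.AlgebraicGeometry.Frobenioids

open Function CategoryTheory Opposite

universe w v u u'

section Monoid

variable {M : Type u} [CommMonoid M]

namespace IsPerfect

/-! ### Roots in a perfect commutative monoid -/

/-- In a perfect monoid the `n`-th power map (`n ≥ 1`) is injective. [cite: MochizukiFrdI2008, §0 p.11] -/
theorem pow_left_injective (h : IsPerfect M) {n : ℕ} (hn : 0 < n) : Injective fun a : M => a ^ n :=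
  (h.bijective_pow n hn).1

/-- Characterisation of the root: `b = root_n a ↔ b^n = a`. [cite: MochizukiFrdI2008, §0 p.11] -/
theorem eq_root_iff (h : IsPerfect M) (n : ℕ+) {a b : M} : b = h.root n a ↔ b ^ (n : ℕ) = a := by
  constructor
  · rintro rfl
    exact h.root_pow n a
  · rintro rfl
    exact (h.root_pow_self n b).symm

/-- `root_n 1 = 1`. [cite: MochizukiFrdI2008, §0 p.11] -/
theorem root_one (h : IsPerfect M) (n : ℕ+) : h.root n 1 = 1 :=
  ((h.eq_root_iff n).mpr (one_pow _)).symm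

/-- `root_n (ab) = root_n a · root_n b`. [cite: MochizukiFrdI2008, §0 p.11] -/
theorem root_mul (h : IsPerfect M) (n : ℕ+) (a b : M) : h.root n (a * b) = h.root n a * h.root n b :=
  ((h.eq_root_iff n).mpr (by rw [mul_pow, h.root_pow, h.root_pow])).symm

/-- `root_1 a = a`. [cite: MochizukiFrdI2008, §0 p.11] -/
theorem root_index_one (h : IsPerfect M) (a : M) : h.root 1 a = a :=
  ((h.eq_root_iff 1).mpr (by rw [PNat.one_coe, pow_one])).symm

/-- The `n`-th root of a perfect monoid as a monoid homomorphism. [cite: MochizukiFrdI2008, §0 p.11] -/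
def rootHom (h : IsPerfect M) (n : ℕ+) : M →* M where
  toFun := h.root n
  map_one' := h.root_one n
  map_mul' := h.root_mul n

/-- `rootHom n a = root_n a`. [cite: MochizukiFrdI2008, §0 p.11] -/
@[simp] theorem rootHom_apply (h : IsPerfect M) (n : ℕ+) (a : M) : h.rootHom n a = h.root n a := rfl

/-- Roots commute with powers: `root_n (a^m) = (root_n a)^m`. [cite: MochizukiFrdI2008, §0 p.11] -/
theorem root_pow_comm (h : IsPerfect M) (n : ℕ+) (m : ℕ) (a : M) : h.root n (a ^ m) = h.root n a ^ m :=
  map_pow (h.rootHom n) a m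

/-! ### The `ℚ_{≥0}`-action `a ↦ a^d` -/

/-- **The power `a ↦ a^d`, `d ∈ ℚ_{≥0}`, of a perfect monoid** — "`Λ_{>0}` acts naturally on `M`", `Λ = ℚ`
(Def. 2.4 (ii) p. 48): the function `IsPerfect.ratPosAct h d` (`d = m/n ↦ root_n (a^m)` on the reduced
numerator/denominator of `d`) as a MONOID HOMOMORPHISM `M → M`. [cite: MochizukiFrdI2008, Def. 2.4(ii) p.48] -/
def ratPow (h : IsPerfect M) (d : ℚ≥0) : M →* M where
  toFun := h.ratPosAct d
  map_one' := by
    show h.root _ ((1 : M) ^ d.num) = 1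
    rw [one_pow, h.root_one]
  map_mul' a b := by
    show h.root _ ((a * b) ^ d.num) = h.root _ (a ^ d.num) * h.root _ (b ^ d.num)
    rw [mul_pow, h.root_mul]

/-- `ratPow` IS t2's `ratPosAct`. [cite: MochizukiFrdI2008, Def. 2.4(ii) p.48] -/
theorem ratPow_apply (h : IsPerfect M) (d : ℚ≥0) (a : M) : h.ratPow d a = h.ratPosAct d a := rfl

/-- `ratPow d a = root_{den d} (a^{num d})`. [cite: MochizukiFrdI2008, Def. 2.4(ii) p.48] -/
theorem ratPow_eq_root (h : IsPerfect M) (d : ℚ≥0) (a : M) :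
    h.ratPow d a = h.root ⟨d.den, d.den_pos⟩ (a ^ d.num) := rfl

/-- `(a^d)^{den d} = a^{num d}`. [cite: MochizukiFrdI2008, Def. 2.4(ii) p.48] -/
theorem ratPow_pow_den (h : IsPerfect M) (d : ℚ≥0) (a : M) : h.ratPow d a ^ d.den = a ^ d.num :=
  h.root_pow ⟨d.den, d.den_pos⟩ _

/-- A representation `d = m/n` of a non-negative rational exists (`m = num d`, `n = den d`); elementary,
kept in this namespace (not Mathlib's `NNRat`). [cite: MochizukiFrdI2008, Def. 2.4(ii) p.48] -/
theorem _root_.Literature.AlgebraicGeometry.Frobenioids.nnrat_exists_eq_natCast_div (d : ℚ≥0) :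
    ∃ m n : ℕ, 0 < n ∧ d = m / n :=
  ⟨d.num, d.den, d.den_pos, (NNRat.num_div_den d).symm⟩

/-- **Independence of the representation**: for ANY `m, n ≥ 1… ` with `d = m/n`, `(a^d)^n = a^m`.
[cite: MochizukiFrdI2008, Def. 2.4(ii) p.48] -/
theorem ratPow_pow_eq (h : IsPerfect M) {d : ℚ≥0} {m n : ℕ} (hn : 0 < n) (hd : d = m / n) (a : M) :
    h.ratPow d a ^ n = a ^ m := by
  have hnd : d.num * n = m * d.den := by
    have h1 : (d.num : ℚ≥0) / d.den = m / n := by rw [NNRat.num_div_den, hd]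
    rw [div_eq_div_iff (Nat.cast_ne_zero.mpr d.den_pos.ne') (Nat.cast_ne_zero.mpr hn.ne')] at h1
    exact_mod_cast h1
  apply h.pow_left_injective d.den_pos
  show (h.ratPow d a ^ n) ^ d.den = (a ^ m) ^ d.den
  rw [pow_right_comm, ratPow_pow_den, ← pow_mul, ← pow_mul, hnd]

/-- **Uniqueness**: if `d = m/n` and `b^n = a^m` then `b = a^d`. [cite: MochizukiFrdI2008, Def. 2.4(ii) p.48] -/
theorem eq_ratPow_of_pow_eq (h : IsPerfect M) {d : ℚ≥0} {m n : ℕ} (hn : 0 < n) (hd : d = m / n) {a b : M}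
    (hb : b ^ n = a ^ m) : b = h.ratPow d a :=
  h.pow_left_injective hn (hb.trans (h.ratPow_pow_eq hn hd a).symm)

/-- `a^{m/n} = root_n (a^m)` for every representation. [cite: MochizukiFrdI2008, Def. 2.4(ii) p.48] -/
theorem ratPow_div (h : IsPerfect M) (m : ℕ) (n : ℕ+) (a : M) :
    h.ratPow ((m : ℚ≥0) / (n : ℕ)) a = h.root n (a ^ m) :=
  (h.eq_ratPow_of_pow_eq n.pos rfl (h.root_pow n (a ^ m))).symm

/-- `a^0 = 1` (the harmless value at `d = 0`). [cite: MochizukiFrdI2008, Def. 2.4(ii) p.48] -/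
@[simp] theorem ratPow_zero (h : IsPerfect M) (a : M) : h.ratPow 0 a = 1 :=
  (h.eq_ratPow_of_pow_eq (m := 0) (n := 1) one_pos (by rw [Nat.cast_zero, zero_div])
    (by rw [pow_one, pow_zero])).symm

/-- `a^1 = a`. [cite: MochizukiFrdI2008, Def. 2.4(ii) p.48] -/
@[simp] theorem ratPow_one (h : IsPerfect M) (a : M) : h.ratPow 1 a = a :=
  (h.eq_ratPow_of_pow_eq (m := 1) (n := 1) one_pos (by rw [Nat.cast_one, div_one]) (by rw [pow_one])).symm

/-- `a^m`, `m ∈ ℕ`, is the `m`-th power (so the action extends `natPosAction`).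
[cite: MochizukiFrdI2008, Def. 2.4(ii) p.48] -/
theorem ratPow_natCast (h : IsPerfect M) (m : ℕ) (a : M) : h.ratPow (m : ℚ≥0) a = a ^ m :=
  (h.eq_ratPow_of_pow_eq (m := m) (n := 1) one_pos (by rw [Nat.cast_one, div_one]) (by rw [pow_one])).symm

/-- `a^{1/n} = root_n a`. [cite: MochizukiFrdI2008, Def. 2.4(ii) p.48] -/
theorem ratPow_inv_natCast (h : IsPerfect M) (n : ℕ+) (a : M) : h.ratPow ((n : ℕ) : ℚ≥0)⁻¹ a = h.root n a :=
  (h.eq_ratPow_of_pow_eq (m := 1) (n := n) n.pos (by rw [Nat.cast_one, one_div])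
    (by rw [pow_one, h.root_pow])).symm

/-- `a^{dd'} = (a^{d'})^d`. [cite: MochizukiFrdI2008, Def. 2.4(ii) p.48] -/
theorem ratPow_mul (h : IsPerfect M) (d d' : ℚ≥0) (a : M) : h.ratPow (d * d') a = h.ratPow d (h.ratPow d' a) := by
  obtain ⟨m, n, hn, rfl⟩ := nnrat_exists_eq_natCast_div d
  obtain ⟨m', n', hn', rfl⟩ := nnrat_exists_eq_natCast_div d'
  symm
  refine h.eq_ratPow_of_pow_eq (m := m * m') (n := n * n') (Nat.mul_pos hn hn') ?_ ?_
  · rw [Nat.cast_mul, Nat.cast_mul, div_mul_div_comm]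
  · have h2 : h.ratPow (m' / n') a ^ n' = a ^ m' := h.ratPow_pow_eq hn' rfl a
    rw [pow_mul, h.ratPow_pow_eq hn rfl, pow_right_comm, h2, ← pow_mul, mul_comm m' m]

/-- `a^{d+d'} = a^d · a^{d'}`. [cite: MochizukiFrdI2008, Def. 2.4(ii) p.48] -/
theorem ratPow_add (h : IsPerfect M) (d d' : ℚ≥0) (a : M) : h.ratPow (d + d') a = h.ratPow d a * h.ratPow d' a := by
  obtain ⟨m, n, hn, rfl⟩ := nnrat_exists_eq_natCast_div d
  obtain ⟨m', n', hn', rfl⟩ := nnrat_exists_eq_natCast_div d'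
  symm
  refine h.eq_ratPow_of_pow_eq (m := m * n' + n * m') (n := n * n') (Nat.mul_pos hn hn') ?_ ?_
  · rw [div_add_div _ _ (Nat.cast_ne_zero.mpr hn.ne') (Nat.cast_ne_zero.mpr hn'.ne'), Nat.cast_add,
      Nat.cast_mul, Nat.cast_mul, Nat.cast_mul]
  · have h1 : h.ratPow (m / n) a ^ (n * n') = a ^ (m * n') := by
      rw [pow_mul, h.ratPow_pow_eq hn rfl, ← pow_mul]
    have h2 : h.ratPow (m' / n') a ^ (n * n') = a ^ (n * m') := by
      rw [mul_comm n n', pow_mul, h.ratPow_pow_eq hn' rfl, ← pow_mul, mul_comm m' n]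
    rw [mul_pow, h1, h2, ← pow_add]

/-- `(a^d)^{1/d} = a` for `d ≠ 0`. [cite: MochizukiFrdI2008, Def. 2.4(ii) p.48] -/
theorem ratPow_inv_ratPow (h : IsPerfect M) {d : ℚ≥0} (hd : d ≠ 0) (a : M) : h.ratPow d⁻¹ (h.ratPow d a) = a := by
  rw [← h.ratPow_mul, inv_mul_cancel₀ hd, h.ratPow_one]

/-- `(a^{1/d})^d = a` for `d ≠ 0`. [cite: MochizukiFrdI2008, Def. 2.4(ii) p.48] -/
theorem ratPow_ratPow_inv (h : IsPerfect M) {d : ℚ≥0} (hd : d ≠ 0) (a : M) : h.ratPow d (h.ratPow d⁻¹ a) = a := by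
  rw [← h.ratPow_mul, mul_inv_cancel₀ hd, h.ratPow_one]

/-- For `d ≠ 0`, `a ↦ a^d` is injective. [cite: MochizukiFrdI2008, Def. 2.4(ii) p.48] -/
theorem ratPow_injective (h : IsPerfect M) {d : ℚ≥0} (hd : d ≠ 0) : Injective (h.ratPow d) :=
  (LeftInverse.injective fun a => h.ratPow_inv_ratPow hd a)

/-- For `d ≠ 0`, `a ↦ a^d` is surjective. [cite: MochizukiFrdI2008, Def. 2.4(ii) p.48] -/
theorem ratPow_surjective (h : IsPerfect M) {d : ℚ≥0} (hd : d ≠ 0) : Surjective (h.ratPow d) :=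
  RightInverse.surjective fun a => h.ratPow_ratPow_inv hd a

/-- For `d ≠ 0`, `a ↦ a^d` is bijective ("`Λ_{>0}` ACTS": by automorphisms of `M`).
[cite: MochizukiFrdI2008, Def. 2.4(ii) p.48] -/
theorem ratPow_bijective (h : IsPerfect M) {d : ℚ≥0} (hd : d ≠ 0) : Bijective (h.ratPow d) :=
  ⟨h.ratPow_injective hd, h.ratPow_surjective hd⟩

/-- **"`Λ_{>0}` acts naturally on `M`", `Λ = ℚ`**: the action as a monoid homomorphism
`(ℚ_{≥0}, ·) → End(M)`, `d ↦ (a ↦ a^d)` — multiplicative in `d`, unital; restrict to `ℚ_{>0}` for the printed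
statement.  Compare `natPosAction` (`Λ = ℤ`), `Supports.realPosAction` (`Λ = ℝ`).
[cite: MochizukiFrdI2008, Def. 2.4(ii) p.48] -/
def ratPosAction (h : IsPerfect M) : ℚ≥0 →* Monoid.End M where
  toFun d := h.ratPow d
  map_one' := MonoidHom.ext fun a => h.ratPow_one a
  map_mul' d d' := MonoidHom.ext fun a => h.ratPow_mul d d' a

/-- `ratPosAction d = ratPow d`. [cite: MochizukiFrdI2008, Def. 2.4(ii) p.48] -/
@[simp] theorem ratPosAction_apply (h : IsPerfect M) (d : ℚ≥0) (a : M) : h.ratPosAction d a = h.ratPow d a := rfl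

/-- **Naturality** ("acts naturally"): every homomorphism `φ : M → M'` between perfect monoids commutes with
the action, `φ(a^d) = φ(a)^d` — since `φ(a^d)^n = φ(a)^m` for `d = m/n`. [cite: MochizukiFrdI2008, Def. 2.4(ii) p.48] -/
theorem map_ratPow (h : IsPerfect M) {M' : Type u'} [CommMonoid M'] (h' : IsPerfect M') (φ : M →* M')
    (d : ℚ≥0) (a : M) : φ (h.ratPow d a) = h'.ratPow d (φ a) := by
  obtain ⟨m, n, hn, rfl⟩ := nnrat_exists_eq_natCast_div d
  exact h'.eq_ratPow_of_pow_eq hn rfl (by rw [← map_pow, h.ratPow_pow_eq hn rfl, map_pow])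

/-- In particular a homomorphism between perfect monoids commutes with roots.
[cite: MochizukiFrdI2008, §0 p.11] -/
theorem map_root (h : IsPerfect M) {M' : Type u'} [CommMonoid M'] (h' : IsPerfect M') (φ : M →* M')
    (n : ℕ+) (a : M) : φ (h.root n a) = h'.root n (φ a) := by
  rw [← h.ratPow_inv_natCast, ← h'.ratPow_inv_natCast, h.map_ratPow h']

end IsPerfect

namespace Supports

/-- If `ℚ` supports `M`, `M` is perfect (Def. 2.4 (ii)(b) — by definition). [cite: MochizukiFrdI2008, Def. 2.4(ii) p.48] -/
theorem isPerfect_Q (hS : Supports M .Q) : IsPerfect M := hS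

/-- If `ℝ` supports `M`, `M` is perfect (Def. 2.4 (ii)(c), first clause), so `ℚ` supports `M` too.
[cite: MochizukiFrdI2008, Def. 2.4(ii) p.48] -/
theorem supportsQ_of_R (hS : Supports M .R) : Supports M .Q := hS.1

end Supports

end Monoid

/-! ### "Multiplication by `d ∈ ℚ_{>0}`" on a monoid `Φ` on `D` supported by `ℚ` (Def. 2.4 (iii)) -/

section OnD

variable {D : Type u} [Category.{v} D] (Φ : Dᵒᵖ ⥤ CommMonCat.{w})
  (hS : ∀ X : Dᵒᵖ, Supports (Φ.obj X) .Q)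

/-- **"Multiplication by `d ∈ ℚ_{>0}`" on a monoid `Φ` on `D` supported by `ℚ`** (Def. 2.4 (iii), `Λ = ℚ`):
the natural endomorphism `Φ → Φ` with components `a ↦ a^d` (`IsPerfect.ratPow`); naturality is
`IsPerfect.map_ratPow` (the pull-backs are homomorphisms between perfect monoids).  (Defined for all
`d ∈ ℚ_{≥0}`; `d = 0` gives the trivial endomorphism.) [cite: MochizukiFrdI2008, Def. 2.4(iii) p.48] -/
def ratPowEnd (d : ℚ≥0) : Φ ⟶ Φ where
  app X := CommMonCat.ofHom ((hS X).isPerfect_Q.ratPow d)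
  naturality X Y f := by
    apply CommMonCat.hom_ext
    apply MonoidHom.ext
    intro a
    change (hS Y).isPerfect_Q.ratPow d ((Φ.map f).hom a) = (Φ.map f).hom ((hS X).isPerfect_Q.ratPow d a)
    exact ((hS X).isPerfect_Q.map_ratPow (hS Y).isPerfect_Q (Φ.map f).hom d a).symm

/-- Components of `ratPowEnd`. [cite: MochizukiFrdI2008, Def. 2.4(iii) p.48] -/
@[simp] theorem ratPowEnd_app_hom (d : ℚ≥0) (X : Dᵒᵖ) :
    ((ratPowEnd Φ hS d).app X).hom = (hS X).isPerfect_Q.ratPow d := rfl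

/-- `ratPowEnd 1 = id`. [cite: MochizukiFrdI2008, Def. 2.4(iii) p.48] -/
theorem ratPowEnd_one : ratPowEnd Φ hS 1 = 𝟙 Φ := by
  ext X a
  exact (hS X).isPerfect_Q.ratPow_one a

/-- `ratPowEnd (d d') = ratPowEnd d' ≫ ratPowEnd d` ("multiplication by `d d'`").
[cite: MochizukiFrdI2008, Def. 2.4(iii) p.48] -/
theorem ratPowEnd_mul (d d' : ℚ≥0) : ratPowEnd Φ hS (d * d') = ratPowEnd Φ hS d' ≫ ratPowEnd Φ hS d := by
  ext X a
  exact (hS X).isPerfect_Q.ratPow_mul d d' a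

/-- For `m ∈ ℕ` the endomorphism is the `m`-th power map. [cite: MochizukiFrdI2008, Def. 2.4(iii) p.48] -/
theorem ratPowEnd_natCast_app (m : ℕ) (X : Dᵒᵖ) (a : Φ.obj X) :
    ((ratPowEnd Φ hS (m : ℚ≥0)).app X).hom a = a ^ m :=
  (hS X).isPerfect_Q.ratPow_natCast m a

/-- Bridge to `Λ = ℤ`: for `d ∈ ℕ_{≥1}` the `ℚ`-action endomorphism IS t2's `powEnd Φ d` (the `d`-th power
maps), so the two "Frobenius functors associated to `d`" on `F_Φ` coincide. [cite: MochizukiFrdI2008, Def. 2.4(iii) p.48] -/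
theorem ratPowEnd_pnat (d : ℕ+) : ratPowEnd Φ hS ((d : ℕ) : ℚ≥0) = powEnd Φ d := by
  ext X a
  exact (hS X).isPerfect_Q.ratPow_natCast d a

/-- "Multiplication by `d ∈ ℚ_{>0}`" is injective on every `Φ(A)`. [cite: MochizukiFrdI2008, Def. 2.4(iii) p.48] -/
theorem ratPowEnd_app_injective {d : ℚ≥0} (hd : d ≠ 0) (X : Dᵒᵖ) :
    Injective ((ratPowEnd Φ hS d).app X).hom :=
  (hS X).isPerfect_Q.ratPow_injective hd

/-- **`d · Φ ⊆ Φ` for `Λ = ℚ`** (Def. 2.4 (iii)): the image subfunctor of "multiplication by `d`", as a monoid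
on `D` (t2's `imageMonoid` at THE endomorphism). [cite: MochizukiFrdI2008, Def. 2.4(iii) p.48] -/
abbrev ratMulImage (d : ℚ≥0) : Dᵒᵖ ⥤ CommMonCat.{w} := imageMonoid (ratPowEnd Φ hS d)

/-- For `d ≠ 0`, "multiplication by `d`" is bijective on each `Φ(A)`, so `d · Φ(A) = Φ(A)`.
[cite: MochizukiFrdI2008, Def. 2.4(iii) p.48] -/
theorem ratMulImage_eq_top {d : ℚ≥0} (hd : d ≠ 0) (X : Dᵒᵖ) : imageSubmonoid (ratPowEnd Φ hS d) X = ⊤ := by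
  rw [eq_top_iff]
  intro a _
  obtain ⟨b, hb⟩ := (hS X).isPerfect_Q.ratPow_surjective hd a
  exact ⟨b, hb⟩

/-- `ℚ` supports THE perfection `Φ^pf` of any monoid `Φ` on `D` (every `Φ^pf(A) = Φ(A)^pf` is perfect,
`isPerfect_perfection`; the monoid-level statement is `supports_Q_perfection`, `RlfPerfFactorial.lean`) —
the case in which print takes `Λ = ℚ`. [cite: MochizukiFrdI2008, Def. 2.4(ii) p.48] -/
theorem supportsQ_perfectionFunctor (Ψ : Dᵒᵖ ⥤ CommMonCat.{w}) (X : Dᵒᵖ) :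
    Supports ((perfectionFunctor Ψ).obj X) .Q :=
  isPerfect_perfection

end OnD

end Literature.AlgebraicGeometry.Frobenioids

end
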